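import Mathlib.NumberTheory.NumberField.Basic
import Literature.AlgebraicGeometry.Motives.FaltingsFinitenessI
import HarnessLib

/-!
# Route PhantomRMYoshida — FaltingsFinitenessI (item stmt-Langlands-15084): the gate item is the Literature fact at `K = ℚ`

The named-fact gate `FaltingsFinitenessI` of route `PhantomRMYoshida` (item stmt-Langlands-15084) is
Faltings' **Finiteness I over `ℚ`**:

  `∀ A : AbelianVariety ℚ, ∃ (n : ℕ) (C : Fin n → AbelianVariety ℚ),
     ∀ B : AbelianVariety ℚ, IsIsogenous B A → ∃ i, Nonempty (B ≅ C i)`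

(Faltings, Invent. Math. 73 (1983), §6, Satz 5–6, with Zarhin's trick; Milne, *Abelian
Varieties* (2008), Ch. IV, Thm. 1.1: up to isomorphism only finitely many abelian varieties over a
number field are isogenous to a given one).  It is VERBATIM the tree's named fact
`Literature.AlgebraicGeometry.Motives.AbelianVariety.finite_isoClasses_isogenous A`
(`Literature/AlgebraicGeometry/Motives/FaltingsFinitenessI.lean`, a `def … : Prop` quantifying
`∀ [NumberField K], …` in its body, without `_holds`) at `K = ℚ`, the instance binder being
supplied by Mathlib's `Rat.numberField`.

The typing is faithful — `AbelianVariety ℚ` is a proper, geometrically integral (Mathlib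
`GeometricallyIntegral`) group scheme over `Spec ℚ`, morphisms are homomorphisms of group schemes,
`B ≅ C i` is an isomorphism of `ℚ`-group schemes and `IsIsogenous B A` an isogeny `B → A`
(surjective and finite homomorphism) — so the item is exactly as strong as the printed theorem,
whose proof (heights on the moduli space, Tate–Raynaud, the Hodge–Tate decomposition) is not in
the tree.  This file records, sorry-free, what the item IS:

* `faltingsFinitenessI_iff_forall_finite_isoClasses_isogenous` — the item `↔` the Literature fact
  at every `A : AbelianVariety ℚ` (both directions are `fun h A ↦ h A`);
* `faltingsFinitenessI_of_forall_finite_isoClasses_isogenous` — the direction that closes the item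
  once the fact is discharged;
* `finite_isoClasses_isogenous_of_faltingsFinitenessI` — the direction in which the tree consumes
  it (`Literature/AlgebraicGeometry/Motives/FaltingsAbelianOfFinitenessIProofs.lean` derives
  Faltings 1983 §5 — Satz 3, Satz 4, Korollar 1–2 — from this fact alone).

The item's statement is spelled out verbatim in every signature: the route file
`Theses/PhantomRMYoshida.lean` (rev 8) does not yet declare `FaltingsFinitenessI`, and no local
abbreviation is introduced, so that this stays a pure-proof file.
-/

set_option linter.dupNamespace false -- as in the sibling Theorems files: `Summit.Langlands.Langlands` is the mandated namespace (summit = sub-problem)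

noncomputable section

open CategoryTheory
open Literature.AlgebraicGeometry.Motives
open Literature.AlgebraicGeometry.Motives.AbelianVariety

namespace Summit.Langlands.Langlands.Theorems.PhantomRMYoshida

/-- **The gate item is the Literature fact at `K = ℚ`.** Finiteness I over `ℚ` as typed in item
stmt-Langlands-15084 holds iff the tree's named fact
`AbelianVariety.finite_isoClasses_isogenous A` (Milne, *Abelian Varieties* (2008), IV Thm. 1.1;
Faltings 1983, §6) holds for every `A : AbelianVariety ℚ`; the fact's inner binder
`∀ [NumberField ℚ]` is discharged by `Rat.numberField`, and both directions are `fun h A ↦ h A`. -/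
theorem faltingsFinitenessI_iff_forall_finite_isoClasses_isogenous :
    (∀ A : AbelianVariety ℚ, ∃ (n : ℕ) (C : Fin n → AbelianVariety ℚ),
        ∀ B : AbelianVariety ℚ, IsIsogenous B A → ∃ i, Nonempty (B ≅ C i)) ↔
      ∀ A : AbelianVariety ℚ, finite_isoClasses_isogenous A :=
  ⟨fun h A _ ↦ h A, fun h A ↦ h A⟩

/-- **Finiteness I over `ℚ` from the Literature fact** (the direction that will close item
stmt-Langlands-15084 once `AbelianVariety.finite_isoClasses_isogenous` is discharged): if the
named fact holds for every abelian variety over `ℚ`, the item's statement follows verbatim. -/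
theorem faltingsFinitenessI_of_forall_finite_isoClasses_isogenous
    (h : ∀ A : AbelianVariety ℚ, finite_isoClasses_isogenous A) :
    ∀ A : AbelianVariety ℚ, ∃ (n : ℕ) (C : Fin n → AbelianVariety ℚ),
      ∀ B : AbelianVariety ℚ, IsIsogenous B A → ∃ i, Nonempty (B ≅ C i) :=
  faltingsFinitenessI_iff_forall_finite_isoClasses_isogenous.2 h

/-- **The Literature fact over `ℚ` from the item**: Finiteness I over `ℚ` (item
stmt-Langlands-15084) gives `AbelianVariety.finite_isoClasses_isogenous A` for every
`A : AbelianVariety ℚ`, the form consumed by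
`Literature/AlgebraicGeometry/Motives/FaltingsAbelianOfFinitenessIProofs.lean`. -/
theorem finite_isoClasses_isogenous_of_faltingsFinitenessI
    (hFin : ∀ A : AbelianVariety ℚ, ∃ (n : ℕ) (C : Fin n → AbelianVariety ℚ),
      ∀ B : AbelianVariety ℚ, IsIsogenous B A → ∃ i, Nonempty (B ≅ C i))
    (A : AbelianVariety ℚ) : finite_isoClasses_isogenous A :=
  faltingsFinitenessI_iff_forall_finite_isoClasses_isogenous.1 hFin A

end Summit.Langlands.Langlands.Theorems.PhantomRMYoshida

end
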